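import Summits.AtomisticToContinuum.Crystallization.Theorems.FrustratedLawDichotomyStrainedPatchHomEntryLeafHTU
import Summits.AtomisticToContinuum.Crystallization.Theorems.FrustratedLawDichotomyStrainedPatchHomEntryFitHcpCentredRotSound

/-!
# The reduced-universe slab leaf with the CENTRED ROTATED inner verdict: `entryLeafOKHT4UQDCR(X)`, soundness, the hcp half, ★★★ `(H) HomFloor (1/625)`
# (27623 `(H) HomFloor (1/625)`, hcp half; hand-1 g32; critic rows 1185 (iii) / 1187 / 1189)

decomp-a2c hand-1 g32 (crux `AperiodicFrustratedLawGap`, stmt-AtomisticToContinuum-27623).  Verbatim the booking section of `…HomEntryFitHcpCentredRotSound`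
(hand-1 g31) with the pruned slab leaf `…HomSlabPrune.entryLeafOKHT5` replaced by the REDUCED-UNIVERSE leaf `…HomEntryLeafHTU.entryLeafOKHT4U` (fused
two-fact certificate side, `≈ 125 s` instead of `≈ 630 s` per cell at `2⁻¹²`): `entryLeafOKHT4UQDCR μ q p t` + `_sound`, the union with payload functions
`entryLeafOKHT4UQDCRX μ P Qf T` + `_sound`, ★★ `hcpHalf_of_entryTreeHT4UQDCRX`, ★★★ `homFloor_625_of_entryTrees6RBKP_HT4UQDCRX` — the consumer for the
production run of the analytic-slab leaf.

Definitions (instances) + soundness; 0 sorry; standard axioms; no instances / notation / `#eval`.  `--supports stmt-AtomisticToContinuum-27623`.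
-/

noncomputable section

namespace Summit.AtomisticToContinuum.Crystallization.Theorems.FrustratedLawDichotomyStrainedPatchHomEntryLeafHT

open scoped BigOperators RealInnerProductSpace
open Literature.Analysis.ValidatedNumerics.Numerics
open Summit.AtomisticToContinuum.Crystallization.Theorems.ChargedEnergyGapNegative (E3)
open Summit.AtomisticToContinuum.Crystallization.Theorems.FrustratedLawDichotomySchurCut (effPot w₄₅ ω₄)
open Summit.AtomisticToContinuum.Crystallization.Theorems.FrustratedLawDichotomyAveragingRuleTightFree (TightNearCap BadNearCap)
open Summit.AtomisticToContinuum.Crystallization.Theorems.FrustratedLawDichotomyExemptAbsorption (ExemptNear)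
open Summit.AtomisticToContinuum.Crystallization.Theorems.FrustratedLawDichotomyStrainedPatchHomSplit (ExRec latPt hexFrame hcpShift HomFloor)
open Summit.AtomisticToContinuum.Crystallization.Theorems.FrustratedLawDichotomyStrainedPatchTaylorChord (segGd)
open Summit.AtomisticToContinuum.Crystallization.Theorems.FrustratedLawDichotomyStrainedPatchHomCoords (apply_eq_sum_entries)
open Summit.AtomisticToContinuum.Crystallization.Theorems.FrustratedLawDichotomyStrainedPatchHomEntryGram (entryFI mem_entryFI)
open Summit.AtomisticToContinuum.Crystallization.Theorems.FrustratedLawDichotomyStrainedPatchHomEntryGramHcp (dot3 shufFI mem_dot3 mem_shufFI)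
open Summit.AtomisticToContinuum.Crystallization.Theorems.FrustratedLawDichotomyStrainedPatchHomCurvCentreKit (cenShuf cenShuf_apply)
open Summit.AtomisticToContinuum.Crystallization.Theorems.FrustratedLawDichotomyStrainedPatchHomCurvLJ (curvCheckLJM)
open Summit.AtomisticToContinuum.Crystallization.Theorems.FrustratedLawDichotomyStrainedPatchHomForceJacN
  (fjQ fjE forceJacCheckN boxLabels11 boxLabels11_toFinset)
open Summit.AtomisticToContinuum.Crystallization.Theorems.FrustratedLawDichotomyStrainedPatchHomForceHcp (xiBallOK norm_le_quarter_of_xiBallOK)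
open Summit.AtomisticToContinuum.Crystallization.Theorems.FrustratedLawDichotomyStrainedPatchHomCurvLeafHCC (entryLeafOKHCCX entryLeafOKHCCX_sound)
open Summit.AtomisticToContinuum.Crystallization.Theorems.FrustratedLawDichotomyStrainedPatchHomSlabConfine (abs_apply_le_of_qcert)
open Summit.AtomisticToContinuum.Crystallization.Theorems.FrustratedLawDichotomyStrainedPatchHomSlabLeaf
  (jac_floorM_of_three_checks abs_coord_le_of_confined hver_of_slabParts)
open Summit.AtomisticToContinuum.Crystallization.Theorems.FrustratedLawDichotomyStrainedPatchHomPrunedPolar (homFloor_of_prunedBoxSums_selfAdjoint)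
open Summit.AtomisticToContinuum.Crystallization.Theorems.FrustratedLawDichotomyStrainedPatchHomCertTree (CertTree treeOK treeOK_sound)
open Summit.AtomisticToContinuum.Crystallization.Theorems.FrustratedLawDichotomyStrainedPatchHomEntryGram (rootC rootW)
open Summit.AtomisticToContinuum.Crystallization.Theorems.FrustratedLawDichotomyStrainedPatchHomEntryGramHcp (rootCH rootWH)
open Summit.AtomisticToContinuum.Crystallization.Theorems.FrustratedLawDichotomyStrainedPatchHomEntryTable (muRec muRec_ok)
open Summit.AtomisticToContinuum.Crystallization.Theorems.FrustratedLawDichotomyStrainedPatchHomEntryTableP (entryLeafOK6RBKP)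
open Summit.AtomisticToContinuum.Crystallization.Theorems.FrustratedLawDichotomyStrainedPatchHomEntryTreeCert (fccHalf_of_entryTree6RBKP)
open Summit.AtomisticToContinuum.Crystallization.Theorems.FrustratedLawDichotomyStrainedPatchHomEntryFlipHcp (HcpDich hcpHalf_of_entryTreeShuf)
open Summit.AtomisticToContinuum.Crystallization.Theorems.FrustratedLawDichotomyStrainedPatchHomEntryFitHcpCentred (entryLeafOKHQDCR entryLeafOKHQDCR_sound)

/-- ★ The reduced-universe slab leaf (fused two-fact certificate side) with inner sub-tree verdict `entryLeafOKHQDCR μ q` (centred rotated ∨ min-pairs ∨ quick). -/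
def entryLeafOKHT4UQDCR (μ : ℤ) (q : Fin 4 → ℤ) (p : HTCert) (t : CertTree ((Fin 3 × Fin 3) ⊕ Fin 3)) (c w : (Fin 3 × Fin 3) ⊕ Fin 3 → ℤ) : Bool :=
  entryLeafOKHT4U (entryLeafOKHQDCR μ q) p t c w

/-- ★★ Soundness of `entryLeafOKHT4UQDCR` in the hver shape. [folklore chaining: `entryLeafOKHT4U_sound` with `entryLeafOKHQDCR_sound`] -/
theorem entryLeafOKHT4UQDCR_sound {μ : ℤ} {q : Fin 4 → ℤ} {p : HTCert} {t : CertTree ((Fin 3 × Fin 3) ⊕ Fin 3)} {c w : (Fin 3 × Fin 3) ⊕ Fin 3 → ℤ}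
    (h : entryLeafOKHT4UQDCR μ q p t c w = true) (U : E3 →L[ℝ] E3) (ξ : E3)
    (hsa : ∀ v v' : E3, ⟪U v, v'⟫ = ⟪v, U v'⟫) (hU : ‖U - 1‖ ≤ 1 / 4)
    (hbox : ∀ ab : Fin 3 × Fin 3, |(U (EuclideanSpace.single ab.2 (1 : ℝ))) ab.1 - (c (Sum.inl ab) : ℝ) / SC| ≤ (w (Sum.inl ab) : ℝ) / SC)
    (hξ : ∀ i : Fin 3, |ξ i - (c (Sum.inr i) : ℝ) / SC| ≤ (w (Sum.inr i) : ℝ) / SC) (h0 : 0 ≤ ξ 0) (h2 : 0 ≤ ξ 2) :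
    (∀ (M : ℕ) (z : Fin M → E3) (cc : Fin M), Function.Injective z →
        Set.range z = {x : E3 | dist x (z cc) ≤ 133 / 10 ∧ ∃ a : Fin 3 → ℤ,
          x = z cc + latPt U hexFrame a ∨ x = z cc + latPt U hexFrame a + U (hcpShift + ξ)} →
        TightNearCap (9 / 5) (3 / 2) z cc ∨ ExemptNear (9 / 5) ExRec z cc ∨ BadNearCap (9 / 5) (3 / 2) z cc) ∨
      (μ : ℝ) / SC ≤ ∑ b ∈ (Fintype.piFinset fun _ : Fin 3 => Finset.Icc (-7 : ℤ) 7).filter (fun b => b ≠ 0), effPot w₄₅ ω₄ (3 / 400) ‖latPt U hexFrame b‖ +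
        ∑ b ∈ (Fintype.piFinset fun _ : Fin 3 => Finset.Icc (-7 : ℤ) 7), effPot w₄₅ ω₄ (3 / 400) ‖latPt U hexFrame b + U (hcpShift + ξ)‖ :=
  entryLeafOKHT4U_sound (fun c' w' hv V η hVsa hV1 hVb hη h0' h2' => entryLeafOKHQDCR_sound c' w' hv V η hVsa hV1 hVb hη h0' h2') h U ξ hsa hU hbox hξ h0 h2

/-- ★ The union verdict with payload FUNCTIONS (certificate `P c w`, inner sub-tree `T c w`), else the union verdict of record `entryLeafOKHCCX μ`. -/
def entryLeafOKHT4UQDCRX (μ : ℤ) (P : ((Fin 3 × Fin 3) ⊕ Fin 3 → ℤ) → ((Fin 3 × Fin 3) ⊕ Fin 3 → ℤ) → HTCert)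
    (Qf : ((Fin 3 × Fin 3) ⊕ Fin 3 → ℤ) → ((Fin 3 × Fin 3) ⊕ Fin 3 → ℤ) → (Fin 4 → ℤ))
    (T : ((Fin 3 × Fin 3) ⊕ Fin 3 → ℤ) → ((Fin 3 × Fin 3) ⊕ Fin 3 → ℤ) → CertTree ((Fin 3 × Fin 3) ⊕ Fin 3))
    (c w : (Fin 3 × Fin 3) ⊕ Fin 3 → ℤ) : Bool :=
  entryLeafOKHT4UQDCR μ (Qf c w) (P c w) (T c w) c w || entryLeafOKHCCX μ c w

/-- ★★ Soundness of `entryLeafOKHT4UQDCRX` in the hver shape. [folklore chaining] -/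
theorem entryLeafOKHT4UQDCRX_sound {μ : ℤ} {P : ((Fin 3 × Fin 3) ⊕ Fin 3 → ℤ) → ((Fin 3 × Fin 3) ⊕ Fin 3 → ℤ) → HTCert}
    {Qf : ((Fin 3 × Fin 3) ⊕ Fin 3 → ℤ) → ((Fin 3 × Fin 3) ⊕ Fin 3 → ℤ) → (Fin 4 → ℤ)}
    {T : ((Fin 3 × Fin 3) ⊕ Fin 3 → ℤ) → ((Fin 3 × Fin 3) ⊕ Fin 3 → ℤ) → CertTree ((Fin 3 × Fin 3) ⊕ Fin 3)}
    {c w : (Fin 3 × Fin 3) ⊕ Fin 3 → ℤ} (h : entryLeafOKHT4UQDCRX μ P Qf T c w = true) (U : E3 →L[ℝ] E3) (ξ : E3)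
    (hsa : ∀ v v' : E3, ⟪U v, v'⟫ = ⟪v, U v'⟫) (hU : ‖U - 1‖ ≤ 1 / 4)
    (hbox : ∀ ab : Fin 3 × Fin 3, |(U (EuclideanSpace.single ab.2 (1 : ℝ))) ab.1 - (c (Sum.inl ab) : ℝ) / SC| ≤ (w (Sum.inl ab) : ℝ) / SC)
    (hξ : ∀ i : Fin 3, |ξ i - (c (Sum.inr i) : ℝ) / SC| ≤ (w (Sum.inr i) : ℝ) / SC) (h0 : 0 ≤ ξ 0) (h2 : 0 ≤ ξ 2) :
    (∀ (M : ℕ) (z : Fin M → E3) (cc : Fin M), Function.Injective z →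
        Set.range z = {x : E3 | dist x (z cc) ≤ 133 / 10 ∧ ∃ a : Fin 3 → ℤ,
          x = z cc + latPt U hexFrame a ∨ x = z cc + latPt U hexFrame a + U (hcpShift + ξ)} →
        TightNearCap (9 / 5) (3 / 2) z cc ∨ ExemptNear (9 / 5) ExRec z cc ∨ BadNearCap (9 / 5) (3 / 2) z cc) ∨
      (μ : ℝ) / SC ≤ ∑ b ∈ (Fintype.piFinset fun _ : Fin 3 => Finset.Icc (-7 : ℤ) 7).filter (fun b => b ≠ 0), effPot w₄₅ ω₄ (3 / 400) ‖latPt U hexFrame b‖ +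
        ∑ b ∈ (Fintype.piFinset fun _ : Fin 3 => Finset.Icc (-7 : ℤ) 7), effPot w₄₅ ω₄ (3 / 400) ‖latPt U hexFrame b + U (hcpShift + ξ)‖ := by
  simp only [entryLeafOKHT4UQDCRX, Bool.or_eq_true] at h
  rcases h with h | h
  · exact entryLeafOKHT4UQDCR_sound h U ξ hsa hU hbox hξ h0 h2
  · exact entryLeafOKHCCX_sound h U ξ hsa hU hbox hξ h0 h2

/-- ★★ The hcp half from ONE certificate tree over `entryLeafOKHT4UQDCRX μ P T`. [folklore chaining] -/
theorem hcpHalf_of_entryTreeHT4UQDCRX {m : ℝ} {μ : ℤ} (hμ : 2 * (m + (-(7175 / 10000) + 3 / 400)) * SC ≤ μ)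
    (P : ((Fin 3 × Fin 3) ⊕ Fin 3 → ℤ) → ((Fin 3 × Fin 3) ⊕ Fin 3 → ℤ) → HTCert)
    (Qf : ((Fin 3 × Fin 3) ⊕ Fin 3 → ℤ) → ((Fin 3 × Fin 3) ⊕ Fin 3 → ℤ) → (Fin 4 → ℤ))
    (T : ((Fin 3 × Fin 3) ⊕ Fin 3 → ℤ) → ((Fin 3 × Fin 3) ⊕ Fin 3 → ℤ) → CertTree ((Fin 3 × Fin 3) ⊕ Fin 3))
    {t : CertTree ((Fin 3 × Fin 3) ⊕ Fin 3)} (h : treeOK (entryLeafOKHT4UQDCRX μ P Qf T) t rootCH rootWH = true) :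
    ∀ (U : E3 →L[ℝ] E3) (ξ : E3), (∀ v w : E3, inner ℝ (U v) w = inner ℝ v (U w)) → (∀ w : E3, 0 ≤ inner ℝ w (U w)) →
      ‖U - 1‖ ≤ 1 / 4 → ‖ξ‖ ≤ 1 / 4 → HcpDich m U ξ :=
  hcpHalf_of_entryTreeShuf hμ (entryLeafOKHT4UQDCRX μ P Qf T) (fun _ _ hv U ξ hsa hU hbox hξ h0 h2 => entryLeafOKHT4UQDCRX_sound hv U ξ hsa hU hbox hξ h0 h2) h

/-- ★★★ **`(H) HomFloor (1/625)` OVER THE REDUCED-UNIVERSE SLAB-WITH-SUB-TREE VERDICT** (`μ = muRec`; any payload functions `P`, `T`). [folklore] -/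
theorem homFloor_625_of_entryTrees6RBKP_HT4UQDCRX (P : ((Fin 3 × Fin 3) ⊕ Fin 3 → ℤ) → ((Fin 3 × Fin 3) ⊕ Fin 3 → ℤ) → HTCert)
    (Qf : ((Fin 3 × Fin 3) ⊕ Fin 3 → ℤ) → ((Fin 3 × Fin 3) ⊕ Fin 3 → ℤ) → (Fin 4 → ℤ))
    (T : ((Fin 3 × Fin 3) ⊕ Fin 3 → ℤ) → ((Fin 3 × Fin 3) ⊕ Fin 3 → ℤ) → CertTree ((Fin 3 × Fin 3) ⊕ Fin 3))
    (hF : ∃ t : CertTree (Fin 3 × Fin 3), treeOK (entryLeafOK6RBKP muRec) t rootC rootW = true)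
    (hH : ∃ t : CertTree ((Fin 3 × Fin 3) ⊕ Fin 3), treeOK (entryLeafOKHT4UQDCRX muRec P Qf T) t rootCH rootWH = true) : HomFloor (1 / 625) := by
  obtain ⟨tF, htF⟩ := hF
  obtain ⟨tH, htH⟩ := hH
  exact homFloor_of_prunedBoxSums_selfAdjoint (fccHalf_of_entryTree6RBKP muRec_ok htF) (hcpHalf_of_entryTreeHT4UQDCRX muRec_ok P Qf T htH)

end Summit.AtomisticToContinuum.Crystallization.Theorems.FrustratedLawDichotomyStrainedPatchHomEntryLeafHT

end
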